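import Summits.BirchSwinnertonDyer.Rank1Residual.Partition.EisensteinKernelDiscriminantType
import Literature.NumberTheory.EllipticCurves.DivisionPolynomialTorsion
import HarnessLib

/-!
# The per-pair certificate `(x₀, D, s)` of the Greenberg–Vatsal parity type at `p = 3`:
# a rational root `x₀` of the `3`-division polynomial `Ψ₃` spans a rational `3`-line whose kernel
# discriminant is the squarefree part `D` of `Ψ₂Sq(x₀) = 4x₀³ + b₂x₀² + 2b₄x₀ + b₆ = D·s²`

HONEST FRAMING (cell `b2b-bsdres-*`, verbatim): the goal of the cell is to DELETE the
COMBINATION-SHAPED residual classes for ALL analytic-rank ≤ 1 curves over ℚ — "full BSD formula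
for every rank ≤ 1 curve in class C" assembled STRICTLY from published theorems — so that the
rank-≤1 remainder becomes exactly the CONSTRUCTION-SHAPED classes, which are TYPED (missing-input
Props), NOT attempted; this is not "finishing BSD". Off-peak literature typer `b2b-bsdres-lit-cgls`
(CGLS22 / GV00, the reducible = Eisenstein column), session 12: the CENSUS-FACING form of the
elementary reduction of sessions 11 (`EisensteinKernelCharacter` → `EisensteinKernelDiscriminant` →
`EisensteinKernelDiscriminantType`), sized ask S16 of `HOME/b2b-bsdres-lit-cgls/CGLS-GV-TYPING.md`
§18.5, whose consumer is the class-closure instrument `KDISC3` (cc-typer-6 GEN 3,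
`HOME/class-closure/O9/KDISC3-typer6.md`: per-row certificate `(x₀, d)`). Theorems only — no
definition, no named fact, nothing booked, no label changed; research-route bookkeeping, no claim
about BSD is made here.

Session 11 read the Greenberg–Vatsal type of a pair `(E, 3)` with `E[3]` reducible off the KERNEL
DISCRIMINANT `D` of a rational `3`-line `Φ ≤ E[3]` (`KernelDisc.gvPar_iff_of_goodOrd` /
`gvPar_iff_of_mult`: `GVPar W 3 ↔ (0 < D ↔ 3 ∣ D)`), the line being GIVEN. This file supplies the
converse bookkeeping that makes `D` CHECKABLE from three rational numbers:

* §9 `three_smul_eq_zero_of_eval_Ψ₃` / `exists_isRationalLine_of_eval_Ψ₃_eq_zero` — if `x₀ ∈ ℚ` is a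
  root of Mathlib's `3`-division polynomial `W.Ψ₃ = 3X⁴ + b₂X³ + 3b₄X² + 3b₆X + b₈` with
  `W.Ψ₂Sq(x₀) = 4x₀³ + b₂x₀² + 2b₄x₀ + b₆ ≠ 0`, then any geometric point `P = (x₀, y)` above `x₀`
  (`WeierstrassCurve.exists_equation`) has order `3` (the tree's triplication formula
  `WeierstrassCurve.three_smul_some_eq_zero_iff`, Silverman *AEC* Ex. 3.7), `Γ_ℚ` acts on it by
  `±1` (the abscissa is rational: `Affine.Y_eq_of_X_eq`), and `ℤP = {O, P, −P} ≤ E[3]` is a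
  RATIONAL `3`-LINE (`IsRationalLine W 3`);
* §10 `exists_isRationalLine_kernelChar_of_cert` — if moreover `D·s² = Ψ₂Sq(x₀)` with `D ∈ ℤ ∖ 0`,
  `s ∈ ℚˣ`, the kernel character of that line is `χ_D`: `(∀ Q ∈ Φ, σQ = Q) ↔ σ√D = √D`
  (session 11's `exists_disc_of_mem` + `smul_geomSqrt_iff_of_eq_mul_sq`);
* §11 the CERTIFICATE THEOREMS — for a squarefree `D`: `gvPar_three_of_cert`
  (`(0 < D ↔ 3 ∣ D) → GVPar W 3`, no reduction hypothesis), `gvPar_three_iff_of_cert_of_goodOrd` /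
  `gvPar_three_iff_of_cert_of_mult` (`GVPar W 3 ↔ (0 < D ↔ 3 ∣ D)` at a good ordinary, resp.
  multiplicative, `3`, globally minimal model; the latter granted the Tate-uniformisation facts
  `hT`, `hT'` as everywhere in the X2 files), the class forms `classX1_three_gvPar_iff_of_cert`,
  `classX2_three_gvPar_iff_of_cert`, and the type-A/B readings `not_gvPar_three_of_cert_of_goodOrd`,
  `not_gvPar_three_of_cert_of_mult`; and the `D`-free statement
  `exists_cert_of_eval_Ψ₃_eq_zero` (ANY rational root of `Ψ₃` off `Ψ₂Sq` yields a line and a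
  certificate — the type does not depend on the root chosen, x1a's `gvType_iff_of_isRationalLine`).

So a census row `(a₁,…,a₆; x₀, D, s)` is verified in the kernel by `norm_num` on three rational
identities — `Ψ₃(x₀) = 0`, `D·s² = Ψ₂Sq(x₀)`, `Squarefree D` — and `decide` on `(0 < D ↔ 3 ∣ D)`
(`Additive.eval_psi3_eq` — already in the tree — and `eval_Ψ₂Sq` unfold Mathlib's polynomials to the printed
quartic / cubic in the `bᵢ`).

References: J. H. Silverman, *The Arithmetic of Elliptic Curves*, GTM 106 (2009), III.2.3 (group
law, duplication), Exercise 3.7 (division polynomials: `ψ₃` vanishes exactly on `E[3] ∖ O`), VIII.§1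
[SilvermanAEC2009]; R. Greenberg, V. Vatsal, Invent. Math. 142 (2000), Thm. (1.3) (the parity
condition on a rational `p`-isogeny kernel) [GreenbergVatsal2000]; HOME/b2b-bsdres-lit-cgls/CGLS-GV-TYPING.md §§18–19.
-/

set_option autoImplicit false

noncomputable section

open scoped Classical NumberField

open WeierstrassCurve Polynomial Literature.NumberTheory.EllipticCurves
  Literature.NumberTheory.EllipticCurves.Rank1Residual Field IsDedekindDomain

namespace Summit.BirchSwinnertonDyer.Rank1Residual

namespace KernelDisc

variable {W : WeierstrassCurve ℚ}

/-! ### §9. From a rational root of `Ψ₃` to a rational `3`-line -/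

-- The unfolding `V.Ψ₃.eval x = 3x⁴ + b₂x³ + 3b₄x² + 3b₆x + b₈` is already in the tree as
-- `Summit.BirchSwinnertonDyer.Rank1Residual.Additive.eval_psi3_eq` (n1011 p03,
-- `Additive/X4ThreeKuriharaCertKernelPsi3.lean`); it is not restated here (the worked certificate of
-- §12 unfolds Mathlib's `Ψ₃` by `simp only [WeierstrassCurve.Ψ₃, …]` directly).

/-- Mathlib's `Ψ₂Sq` evaluated: `Ψ₂Sq(x) = 4x³ + b₂x² + 2b₄x + b₆` (`= (2y + a₁x + a₃)²` on the
curve, `sq_eq_twoTorsionPolynomial`). [folklore] -/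
theorem eval_Ψ₂Sq {R : Type*} [CommRing R] (V : WeierstrassCurve R) (x : R) :
    V.Ψ₂Sq.eval x = 4 * x ^ 3 + V.b₂ * x ^ 2 + 2 * V.b₄ * x + V.b₆ := by
  simp only [WeierstrassCurve.Ψ₂Sq, eval_add, eval_mul, eval_pow, eval_C, eval_X]

/-- `Ψ₃` commutes with base change at a rational argument. [folklore] -/
theorem eval_Ψ₃_baseChange (K : Type*) [CommRing K] [Algebra ℚ K] (W : WeierstrassCurve ℚ)
    (x₀ : ℚ) : (W.baseChange K).Ψ₃.eval (algebraMap ℚ K x₀) = algebraMap ℚ K (W.Ψ₃.eval x₀) := by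
  rw [WeierstrassCurve.baseChange, map_Ψ₃, eval_map, eval₂_at_apply]

/-- `Ψ₂Sq` commutes with base change at a rational argument. [folklore] -/
theorem eval_Ψ₂Sq_baseChange (K : Type*) [CommRing K] [Algebra ℚ K] (W : WeierstrassCurve ℚ)
    (x₀ : ℚ) : (W.baseChange K).Ψ₂Sq.eval (algebraMap ℚ K x₀) = algebraMap ℚ K (W.Ψ₂Sq.eval x₀) := by
  rw [WeierstrassCurve.baseChange, map_Ψ₂Sq, eval_map, eval₂_at_apply]

/-- On the curve, `(y − (−y − a₁x − a₃))² = Ψ₂Sq(x)`. [folklore] -/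
theorem sub_negY_sq_eq_eval_Ψ₂Sq {K : Type*} [Field K] (V : WeierstrassCurve K) {x y : K}
    (h : V.toAffine.Equation x y) : (y - V.toAffine.negY x y) ^ 2 = V.Ψ₂Sq.eval x := by
  rw [eval_Ψ₂Sq, Affine.negY, ← sq_eq_twoTorsionPolynomial V h]
  ring

/-- **A point above a rational root of `Ψ₃` off `Ψ₂Sq` has order `3`** (the triplication formula,
Silverman *AEC* Ex. 3.7 / III.2.3(d), in the tree as `WeierstrassCurve.three_smul_some_eq_zero_iff`).
[folklore] -/
theorem three_smul_eq_zero_of_eval_Ψ₃ {x₀ : ℚ} (hψ : W.Ψ₃.eval x₀ = 0) (hd : W.Ψ₂Sq.eval x₀ ≠ 0)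
    {y : AlgebraicClosure ℚ}
    (h : (W.baseChange (AlgebraicClosure ℚ)).toAffine.Nonsingular (algebraMap ℚ (AlgebraicClosure ℚ) x₀) y) :
    (3 : ℤ) • (Affine.Point.some (algebraMap ℚ (AlgebraicClosure ℚ) x₀) y h : W.geomPoints) = 0 := by
  have hd' : (W.baseChange (AlgebraicClosure ℚ)).Ψ₂Sq.eval (algebraMap ℚ (AlgebraicClosure ℚ) x₀) ≠ 0 := by
    rw [eval_Ψ₂Sq_baseChange]
    exact (map_ne_zero_iff _ (algebraMap ℚ (AlgebraicClosure ℚ)).injective).mpr hd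
  have hy : y ≠ (W.baseChange (AlgebraicClosure ℚ)).toAffine.negY (algebraMap ℚ (AlgebraicClosure ℚ) x₀) y := by
    intro e
    apply hd'
    rw [← sub_negY_sq_eq_eval_Ψ₂Sq _ h.left, sub_eq_zero.mpr e, zero_pow two_ne_zero]
  have := (WeierstrassCurve.three_smul_some_eq_zero_iff h hy).mpr (by
    rw [ψ_three, evalEval_C, eval_Ψ₃_baseChange, hψ, map_zero])
  exact this

/-- **`Γ_ℚ` acts by `±1` on a geometric point with rational abscissa**: `σ(x₀, y) = (x₀, σy)` lies
above `x₀`, so it is `(x₀, y)` or `−(x₀, y) = (x₀, −y − a₁x₀ − a₃)` (`Affine.Y_eq_of_X_eq`).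
[folklore] -/
theorem smul_eq_or_eq_neg_of_rational_X (σ : absoluteGaloisGroup ℚ) {P : W.geomPoints} {x₀ : ℚ}
    {y : AlgebraicClosure ℚ}
    {h : (W.baseChange (AlgebraicClosure ℚ)).toAffine.Nonsingular (algebraMap ℚ (AlgebraicClosure ℚ) x₀) y}
    (hP : P = Affine.Point.some (algebraMap ℚ (AlgebraicClosure ℚ) x₀) y h) :
    σ • P = P ∨ σ • P = -P := by
  have hσx : σ • algebraMap ℚ (AlgebraicClosure ℚ) x₀ = algebraMap ℚ (AlgebraicClosure ℚ) x₀ :=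
    smul_algebraMap σ x₀
  have hσy : σ • y = absoluteGaloisGroup.toAlgEquiv ℚ σ y := rfl
  -- `σ y` satisfies the Weierstrass equation above `x₀`
  have heq : (W.baseChange (AlgebraicClosure ℚ)).toAffine.Equation (algebraMap ℚ (AlgebraicClosure ℚ) x₀) y :=
    h.left
  have ha₁ : absoluteGaloisGroup.toAlgEquiv ℚ σ (W.baseChange (AlgebraicClosure ℚ)).a₁ =
      (W.baseChange (AlgebraicClosure ℚ)).a₁ := (absoluteGaloisGroup.toAlgEquiv ℚ σ).commutes W.a₁
  have ha₂ : absoluteGaloisGroup.toAlgEquiv ℚ σ (W.baseChange (AlgebraicClosure ℚ)).a₂ =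
      (W.baseChange (AlgebraicClosure ℚ)).a₂ := (absoluteGaloisGroup.toAlgEquiv ℚ σ).commutes W.a₂
  have ha₃ : absoluteGaloisGroup.toAlgEquiv ℚ σ (W.baseChange (AlgebraicClosure ℚ)).a₃ =
      (W.baseChange (AlgebraicClosure ℚ)).a₃ := (absoluteGaloisGroup.toAlgEquiv ℚ σ).commutes W.a₃
  have ha₄ : absoluteGaloisGroup.toAlgEquiv ℚ σ (W.baseChange (AlgebraicClosure ℚ)).a₄ =
      (W.baseChange (AlgebraicClosure ℚ)).a₄ := (absoluteGaloisGroup.toAlgEquiv ℚ σ).commutes W.a₄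
  have ha₆ : absoluteGaloisGroup.toAlgEquiv ℚ σ (W.baseChange (AlgebraicClosure ℚ)).a₆ =
      (W.baseChange (AlgebraicClosure ℚ)).a₆ := (absoluteGaloisGroup.toAlgEquiv ℚ σ).commutes W.a₆
  have hfx : absoluteGaloisGroup.toAlgEquiv ℚ σ (algebraMap ℚ (AlgebraicClosure ℚ) x₀) =
      algebraMap ℚ (AlgebraicClosure ℚ) x₀ := (absoluteGaloisGroup.toAlgEquiv ℚ σ).commutes x₀
  have heq' : (W.baseChange (AlgebraicClosure ℚ)).toAffine.Equation (algebraMap ℚ (AlgebraicClosure ℚ) x₀)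
      (absoluteGaloisGroup.toAlgEquiv ℚ σ y) := by
    rw [Affine.equation_iff] at heq ⊢
    have e := congrArg (absoluteGaloisGroup.toAlgEquiv ℚ σ) heq
    simp only [map_add, map_mul, map_pow, ha₁, ha₂, ha₃, ha₄, ha₆, hfx] at e
    exact e
  rcases Affine.Y_eq_of_X_eq heq' heq rfl with e | e
  · left
    refine ((smul_eq_iff σ hP).1).mpr ⟨hσx, ?_⟩
    rw [hσy, e]
  · right
    refine ((smul_eq_iff σ hP).2).mpr ⟨hσx, ?_⟩
    rw [hσy, e, Affine.negY]

/-- **A rational root of `Ψ₃` spans a rational `3`-line.** For `x₀ ∈ ℚ` with `Ψ₃(x₀) = 0` and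
`Ψ₂Sq(x₀) ≠ 0` there are a geometric point `P = (x₀, y)` of order `3` and the RATIONAL LINE
`Φ = ℤP = {O, P, −P} ≤ E[3]` (order `3`, `Γ_ℚ`-stable since `σP = ±P`). Silverman *AEC* Ex. 3.7,
III.2.3. [folklore] -/
theorem exists_isRationalLine_of_eval_Ψ₃_eq_zero [W.IsElliptic] (x₀ : ℚ) (hψ : W.Ψ₃.eval x₀ = 0)
    (hd : W.Ψ₂Sq.eval x₀ ≠ 0) :
    ∃ (Φ : AddSubgroup (geomTorsion W ((3 : ℕ) : ℤ))) (P : geomTorsion W ((3 : ℕ) : ℤ))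
      (y : AlgebraicClosure ℚ)
      (h : (W.baseChange (AlgebraicClosure ℚ)).toAffine.Nonsingular (algebraMap ℚ (AlgebraicClosure ℚ) x₀) y),
      IsRationalLine W 3 Φ ∧ P ∈ Φ ∧ P ≠ 0 ∧
        (P : W.geomPoints) = Affine.Point.some (algebraMap ℚ (AlgebraicClosure ℚ) x₀) y h := by
  -- a geometric point above `x₀`
  obtain ⟨y, hyeq⟩ := (W.baseChange (AlgebraicClosure ℚ)).exists_equation (algebraMap ℚ (AlgebraicClosure ℚ) x₀)
  have h : (W.baseChange (AlgebraicClosure ℚ)).toAffine.Nonsingular (algebraMap ℚ (AlgebraicClosure ℚ) x₀) y :=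
    (W.baseChange (AlgebraicClosure ℚ)).toAffine.equation_iff_nonsingular.mp hyeq
  set P₀ : W.geomPoints := Affine.Point.some (algebraMap ℚ (AlgebraicClosure ℚ) x₀) y h with hP₀
  have h3 : ((3 : ℕ) : ℤ) • P₀ = 0 := by
    rw [Nat.cast_ofNat]
    exact three_smul_eq_zero_of_eval_Ψ₃ hψ hd h
  have hmem : P₀ ∈ geomTorsion W ((3 : ℕ) : ℤ) := mem_torsionBy_iff.mpr h3
  set P : geomTorsion W ((3 : ℕ) : ℤ) := ⟨P₀, hmem⟩ with hP
  have hP0 : P ≠ 0 := fun e ↦ Affine.Point.some_ne_zero h (congrArg Subtype.val e)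
  have hq₀ : ∀ σ : absoluteGaloisGroup ℚ, σ • P₀ = P₀ ∨ σ • P₀ = -P₀ :=
    fun σ ↦ smul_eq_or_eq_neg_of_rational_X σ hP₀
  have hq : ∀ σ : absoluteGaloisGroup ℚ, σ • P = P ∨ σ • P = -P := fun σ ↦ by
    rcases hq₀ σ with e | e
    · exact Or.inl (Subtype.ext e)
    · exact Or.inr (Subtype.ext e)
  have h3P : (3 : ℕ) • P = 0 := by
    apply Subtype.ext
    simp only [AddSubmonoidClass.coe_nsmul, ZeroMemClass.coe_zero, hP]
    rw [← natCast_zsmul]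
    exact h3
  refine ⟨AddSubgroup.zmultiples P, P, y, h, ⟨?_, ?_⟩, AddSubgroup.mem_zmultiples P, hP0, rfl⟩
  · rw [Nat.card_zmultiples, addOrderOf_eq_prime h3P hP0]
  · intro σ Q hQ
    obtain ⟨n, rfl⟩ := AddSubgroup.mem_zmultiples_iff.mp hQ
    rw [smul_comm]
    rcases hq σ with e | e
    · rw [e]
      exact hQ
    · rw [e, smul_neg]
      exact neg_mem hQ

/-! ### §10. The kernel character of the certified line -/

/-- **The kernel character of the line through `(x₀, y)` is `χ_D`, `D·s² = Ψ₂Sq(x₀)`.** For a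
rational root `x₀` of `Ψ₃` and `D ∈ ℤ ∖ 0`, `s ∈ ℚˣ` with `D·s² = Ψ₂Sq(x₀) = 4x₀³ + b₂x₀² + 2b₄x₀ + b₆`:
there is a rational `3`-line `Φ` with `(∀ Q ∈ Φ, σQ = Q) ↔ σ√D = √D` for every `σ ∈ Γ_ℚ`.
[folklore] -/
theorem exists_isRationalLine_kernelChar_of_cert [W.IsElliptic] {x₀ s : ℚ} {D : ℤ}
    (hψ : W.Ψ₃.eval x₀ = 0) (hD0 : D ≠ 0) (hs : s ≠ 0) (hDs : (D : ℚ) * s ^ 2 = W.Ψ₂Sq.eval x₀) :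
    ∃ Φ : AddSubgroup (geomTorsion W ((3 : ℕ) : ℤ)), IsRationalLine W 3 Φ ∧
      ∀ σ : absoluteGaloisGroup ℚ, (∀ Q ∈ Φ, σ • Q = Q) ↔ σ • geomSqrt (D : ℚ) = geomSqrt (D : ℚ) := by
  have hd : W.Ψ₂Sq.eval x₀ ≠ 0 := by
    rw [← hDs]
    exact mul_ne_zero (Int.cast_ne_zero.mpr hD0) (pow_ne_zero 2 hs)
  obtain ⟨Φ, P, y, h, hΦ, hP, hP0, hPe⟩ := exists_isRationalLine_of_eval_Ψ₃_eq_zero x₀ hψ hd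
  have h32 : (3 : ℕ) ≠ 2 := by decide
  have hq := isQuadratic_three hΦ
  obtain ⟨x₁, y₁, h₁, hPe₁, -, hχ₁⟩ := exists_disc_of_mem hΦ h32 hq hP hP0
  -- the abscissa found by `exists_disc_of_mem` is `x₀`
  have hx : x₁ = x₀ := by
    have e := hPe₁.symm.trans hPe
    injection e with ex _
    exact (algebraMap ℚ (AlgebraicClosure ℚ)).injective ex
  subst hx
  refine ⟨Φ, hΦ, fun σ ↦ ?_⟩
  rw [forall_smul_eq_iff_of_mem hΦ hP hP0 σ, hχ₁ σ]
  have hd' : 4 * x₁ ^ 3 + W.b₂ * x₁ ^ 2 + 2 * W.b₄ * x₁ + W.b₆ = (D : ℚ) * s ^ 2 := by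
    rw [hDs, eval_Ψ₂Sq]
  exact smul_geomSqrt_iff_of_eq_mul_sq (Int.cast_ne_zero.mpr hD0) hs hd' σ

/-! ### §11. The certificate theorems -/

section Cert

variable [W.IsElliptic] {x₀ s : ℚ} {D : ℤ}
  (hψ : W.Ψ₃.eval x₀ = 0) (hsq : Squarefree D) (hs : s ≠ 0)
  (hDs : (D : ℚ) * s ^ 2 = W.Ψ₂Sq.eval x₀)

include hψ hsq hs hDs

/-- **Type B certificate (no reduction hypothesis).** `Ψ₃(x₀) = 0`, `D` squarefree, `s ≠ 0`,
`D·s² = Ψ₂Sq(x₀)` and `(0 < D ↔ 3 ∣ D)` — i.e. `D ∈ 3ℤ_{>0} ∪ (ℤ_{<0} ∖ 3ℤ)` — give `GVPar W 3`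
(`gvPar_of_iff`). [folklore] -/
theorem gvPar_three_of_cert (h : 0 < D ↔ (3 : ℤ) ∣ D) : GVPar W 3 := by
  obtain ⟨Φ, hΦ, hχ⟩ := exists_isRationalLine_kernelChar_of_cert hψ hsq.ne_zero hs hDs
  have h32 : (3 : ℕ) ≠ 2 := by decide
  have hq := isQuadratic_three hΦ
  have hχ' := forall_smul_eq_neg_iff hΦ h32 hq hsq.ne_zero hχ
  exact gvPar_of_iff hΦ h32 hsq.ne_zero hsq hχ hχ' (by simpa using h)

/-- **The certificate at a good ORDINARY `3`** (globally minimal model): `GVPar W 3 ↔ (0 < D ↔ 3 ∣ D)`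
(`gvPar_iff_of_goodOrd`: the type does not depend on the line). [folklore] -/
theorem gvPar_three_iff_of_cert_of_goodOrd [W.IsGloballyMinimal] (hgood : W.HasGoodReductionAtPrime 3)
    (hord : ¬ ((3 : ℕ) : ℤ) ∣ W.frobeniusTrace 3) : GVPar W 3 ↔ (0 < D ↔ (3 : ℤ) ∣ D) := by
  obtain ⟨Φ, hΦ, hχ⟩ := exists_isRationalLine_kernelChar_of_cert hψ hsq.ne_zero hs hDs
  have h32 : (3 : ℕ) ≠ 2 := by decide
  have hq := isQuadratic_three hΦ
  have hχ' := forall_smul_eq_neg_iff hΦ h32 hq hsq.ne_zero hχ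
  have := gvPar_iff_of_goodOrd hΦ h32 hsq.ne_zero hsq hχ hχ' hgood hord
  simpa using this

/-- **The certificate at a MULTIPLICATIVE `3`** (globally minimal model; granted the
Tate-uniformisation facts `hT`, `hT'` as in `gvPar_iff_of_mult`): `GVPar W 3 ↔ (0 < D ↔ 3 ∣ D)`.
[cite: SilvermanATAEC1994, Thm. V.5.3 and Cor. V.5.4] -/
theorem gvPar_three_iff_of_cert_of_mult [W.IsGloballyMinimal]
    (hT : Silverman1994_thmV53_tateUniformisation.{0})
    (hT' : Silverman1994_thmV53_corV54_tateUniformisation.{0})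
    (hmult : W.HasMultiplicativeReductionAtPrime 3) : GVPar W 3 ↔ (0 < D ↔ (3 : ℤ) ∣ D) := by
  obtain ⟨Φ, hΦ, hχ⟩ := exists_isRationalLine_kernelChar_of_cert hψ hsq.ne_zero hs hDs
  have h32 : (3 : ℕ) ≠ 2 := by decide
  have hq := isQuadratic_three hΦ
  have hχ' := forall_smul_eq_neg_iff hΦ h32 hq hsq.ne_zero hχ
  have := gvPar_iff_of_mult hΦ h32 hsq.ne_zero hsq hχ hχ' hT hT' hmult
  simpa using this

/-- **Type A reading at a good ordinary `3`**: a certificate with `¬ (0 < D ↔ 3 ∣ D)` — i.e.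
`D ∈ (ℤ_{>0} ∖ 3ℤ) ∪ 3ℤ_{<0}`, in particular `D = 1` (rational `3`-torsion) or `D = −3`
(`μ₃`-kernel) — excludes the Greenberg–Vatsal parity condition. [folklore] -/
theorem not_gvPar_three_of_cert_of_goodOrd [W.IsGloballyMinimal]
    (hgood : W.HasGoodReductionAtPrime 3) (hord : ¬ ((3 : ℕ) : ℤ) ∣ W.frobeniusTrace 3)
    (h : ¬ (0 < D ↔ (3 : ℤ) ∣ D)) : ¬ GVPar W 3 :=
  fun hB ↦ h ((gvPar_three_iff_of_cert_of_goodOrd hψ hsq hs hDs hgood hord).mp hB)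

/-- **Type A reading at a multiplicative `3`** (granted `hT`, `hT'`). [cite: SilvermanATAEC1994, Thm. V.5.3 and Cor. V.5.4] -/
theorem not_gvPar_three_of_cert_of_mult [W.IsGloballyMinimal]
    (hT : Silverman1994_thmV53_tateUniformisation.{0})
    (hT' : Silverman1994_thmV53_corV54_tateUniformisation.{0})
    (hmult : W.HasMultiplicativeReductionAtPrime 3) (h : ¬ (0 < D ↔ (3 : ℤ) ∣ D)) : ¬ GVPar W 3 :=
  fun hB ↦ h ((gvPar_three_iff_of_cert_of_mult hψ hsq hs hDs hT hT' hmult).mp hB)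

/-- **CLASS X1 at `p = 3` with a certificate** (`ClassX1 W 3`: reducible, good, anomalous — hence
ordinary, `goodOrd_of_anom`): `GVPar W 3 ↔ (0 < D ↔ 3 ∣ D)`; N1′ (type B) iff the right side
holds, N1 / N1″ (type A) iff it fails. Research route; no claim about BSD is made here. [folklore] -/
theorem classX1_three_gvPar_iff_of_cert [W.IsGloballyMinimal] (hX1 : ClassX1 W 3) :
    GVPar W 3 ↔ (0 < D ↔ (3 : ℤ) ∣ D) :=
  gvPar_three_iff_of_cert_of_goodOrd hψ hsq hs hDs (goodOrd_of_anom W 3 hX1.2.2.2.1).1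
    (goodOrd_of_anom W 3 hX1.2.2.2.1).2

/-- **CLASS X2 at `p = 3` with a certificate** (`ClassX2 W 3`: reducible, multiplicative; granted
`hT`, `hT'`): `GVPar W 3 ↔ (0 < D ↔ 3 ∣ D)` — the GV sub-cells (`CellA`, `Cell…GV`) iff the right
side holds. Research route; no claim about BSD is made here.
[cite: SilvermanATAEC1994, Thm. V.5.3 and Cor. V.5.4] -/
theorem classX2_three_gvPar_iff_of_cert [W.IsGloballyMinimal]
    (hT : Silverman1994_thmV53_tateUniformisation.{0})
    (hT' : Silverman1994_thmV53_corV54_tateUniformisation.{0}) (hX2 : ClassX2 W 3) :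
    GVPar W 3 ↔ (0 < D ↔ (3 : ℤ) ∣ D) :=
  gvPar_three_iff_of_cert_of_mult hψ hsq hs hDs hT hT' hX2.2.2

end Cert

/-- **Every rational root of `Ψ₃` off `Ψ₂Sq` yields a certificate.** For `x₀ ∈ ℚ` with
`Ψ₃(x₀) = 0`, `Ψ₂Sq(x₀) ≠ 0`: there are a rational `3`-line `Φ`, a squarefree `D ≠ 0` and `s ≠ 0`
with `D·s² = Ψ₂Sq(x₀)` and kernel character `χ_D`; consequently (§11) the Greenberg–Vatsal type at a
good ordinary / multiplicative `3` is `(0 < D ↔ 3 ∣ D)` for THIS `D` — whichever rational root `x₀`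
(whichever rational `3`-line) is used. [folklore] -/
theorem exists_cert_of_eval_Ψ₃_eq_zero [W.IsElliptic] (x₀ : ℚ) (hψ : W.Ψ₃.eval x₀ = 0)
    (hd : W.Ψ₂Sq.eval x₀ ≠ 0) :
    ∃ (Φ : AddSubgroup (geomTorsion W ((3 : ℕ) : ℤ))) (D : ℤ) (s : ℚ), IsRationalLine W 3 Φ ∧
      Squarefree D ∧ D ≠ 0 ∧ s ≠ 0 ∧ (D : ℚ) * s ^ 2 = W.Ψ₂Sq.eval x₀ ∧
      ∀ σ : absoluteGaloisGroup ℚ, (∀ Q ∈ Φ, σ • Q = Q) ↔ σ • geomSqrt (D : ℚ) = geomSqrt (D : ℚ) := by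
  obtain ⟨D, s, hsq, hD0, hs, hDs⟩ := exists_squarefree_mul_sq (W.Ψ₂Sq.eval x₀) hd
  obtain ⟨Φ, hΦ, hχ⟩ := exists_isRationalLine_kernelChar_of_cert hψ hD0 hs hDs.symm
  exact ⟨Φ, D, s, hΦ, hsq, hD0, hs, hDs.symm, hχ⟩

/-! ### §12. A worked certificate (how a census row is checked)

The quadratic twist by `t = −7` of the `3`-torsion curve `y² + xy + y = x³ + 4x − 6` (conductor
`14`), in the model `W = [1, −2, 1, 220, 1972]` (`b₂ = −7`, `b₄ = 441`, `b₆ = 7889`, `b₈ = −62426`,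
`Δ = −2582630848`): BOTH rational roots of `Ψ₃` certify type B —
`x₀ = −14`, `Ψ₂Sq(−14) = −16807 = (−7)·49²` (the twisted `ℤ/3`-line: `D = −7 < 0`, `3 ∤ D`, odd
unramified), and `x₀ = 7/3`, `Ψ₂Sq(7/3) = 268912/27 = 21·(196/9)²` (the twisted `μ₃`-line:
`D = 21 > 0`, `3 ∣ D`, even ramified). Three `norm_num` identities and one `decide` each; no
reduction hypothesis is needed for the type-B direction (`gvPar_three_of_cert`). -/

/-- The twist by `−7` of `14a1`'s model, certificate at the twisted `ℤ/3`-line `x₀ = −14`: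
`GVPar W 3`. [folklore] -/
example : GVPar (⟨1, -2, 1, 220, 1972⟩ : WeierstrassCurve ℚ) 3 := by
  haveI : (⟨1, -2, 1, 220, 1972⟩ : WeierstrassCurve ℚ).IsElliptic := ⟨by
    rw [isUnit_iff_ne_zero]
    norm_num [WeierstrassCurve.Δ, WeierstrassCurve.b₂, WeierstrassCurve.b₄, WeierstrassCurve.b₆,
      WeierstrassCurve.b₈]⟩
  refine gvPar_three_of_cert (x₀ := -14) (s := 49) (D := -7) ?_ ?_ (by norm_num) ?_ (by decide)
  · simp only [WeierstrassCurve.Ψ₃, eval_add, eval_mul, eval_pow, eval_C, eval_X, eval_ofNat]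
    norm_num [WeierstrassCurve.b₂, WeierstrassCurve.b₄, WeierstrassCurve.b₆, WeierstrassCurve.b₈]
  · exact (Int.prime_iff_natAbs_prime.mpr (by norm_num)).squarefree
  · rw [eval_Ψ₂Sq]
    norm_num [WeierstrassCurve.b₂, WeierstrassCurve.b₄, WeierstrassCurve.b₆]

/-- Same curve, certificate at the OTHER rational root `x₀ = 7/3` (the twisted `μ₃`-line,
`D = 21`): the same verdict `GVPar W 3` — the type does not depend on the line. [folklore] -/
example : GVPar (⟨1, -2, 1, 220, 1972⟩ : WeierstrassCurve ℚ) 3 := by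
  haveI : (⟨1, -2, 1, 220, 1972⟩ : WeierstrassCurve ℚ).IsElliptic := ⟨by
    rw [isUnit_iff_ne_zero]
    norm_num [WeierstrassCurve.Δ, WeierstrassCurve.b₂, WeierstrassCurve.b₄, WeierstrassCurve.b₆,
      WeierstrassCurve.b₈]⟩
  refine gvPar_three_of_cert (x₀ := 7 / 3) (s := 196 / 9) (D := 21) ?_ ?_ (by norm_num) ?_ (by decide)
  · simp only [WeierstrassCurve.Ψ₃, eval_add, eval_mul, eval_pow, eval_C, eval_X, eval_ofNat]
    norm_num [WeierstrassCurve.b₂, WeierstrassCurve.b₄, WeierstrassCurve.b₆, WeierstrassCurve.b₈]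
  · have h : Squarefree ((3 * 7 : ℕ) : ℤ) := by
      rw [Int.squarefree_natCast, Nat.squarefree_mul_iff]
      exact ⟨by norm_num, Nat.prime_three.prime.squarefree, (by norm_num : Nat.Prime 7).prime.squarefree⟩
    exact_mod_cast h
  · rw [eval_Ψ₂Sq]
    norm_num [WeierstrassCurve.b₂, WeierstrassCurve.b₄, WeierstrassCurve.b₆]

end KernelDisc

end Summit.BirchSwinnertonDyer.Rank1Residual

end
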